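import Literature.MathematicalPhysics.QuantumLattice.LinearMatrixODEProofs
import Literature.MathematicalPhysics.QuantumLattice.LiebRobinsonBoundProofs
import Mathlib.MeasureTheory.Integral.IntervalIntegral.FundThmCalculus
import HarnessLib

/-!
# Lieb–Robinson bounds for flows of time-dependent finite-range generators

Fourteenth file of the formalisation of the Michalakis–Zwolak stability theorem (hubbard.S19):
the locality engine for the quasi-adiabatic (spectral-flow) automorphism
`α_s(A) = U(s)ᴴ A U(s)`, `∂_s U = i D(s) U` (Michalakis–Zwolak, arXiv:1109.1588 §5.2, Lemma 2:
"the unitary `U(s)` … satisfies a Lieb–Robinson bound"), in the finite-range time-dependent form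
of Bachmann–Michalakis–Nachtergaele–Sims, CMP **309** (2012) 835 = arXiv:1102.0842, §4.2
Theorem 4.6, whose proof is followed:

* `exists_unitary_propagator` — the unitary propagator of a continuous bounded Hermitian
  generator on `[0, T]` (from `exists_unitary_flow` of `LinearMatrixODEProofs`);
* `hasDerivWithinAt_conj_flow` — `(Uᴴ A U)' = Uᴴ (A B − B A) U` for `U' = B U`, `Bᴴ = −B`;
* `norm_le_norm_add_integral_of_hasDerivWithinAt` — the norm-preserving term lemma in
  time-dependent form: `f' = f K − K f + h` with `K(s)` anti-Hermitian gives
  `‖f(t)‖ ≤ ‖f(0)‖ + ∫₀ᵗ ‖h‖` (conjugation by the propagator of `K` and the fundamental theorem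
  of calculus; BMNS p. 12 "as the first term above is norm-preserving");
* `norm_comm_flow_le_integral_sum` — the integral inequality
  `‖[α_t(A), B]‖ ≤ ‖[A, B]‖ + 2‖A‖ ∫₀ᵗ Σ_{Z ∩ X ≠ ∅} ‖[α_s(Ψ_s Z), B]‖ ds` for `A ∈ 𝔄_X`
  (locality removes the terms not meeting `X` from the generator of `α_s(A)`; the Jacobi identity
  puts `f = [α_s A, B]` in the norm-preserving form);
* `norm_comm_flow_le_iterate`, `norm_comm_flow_le_exp` — the iteration of
  `LiebRobinsonBoundProofs` (abstract integer grading for finite-range terms) repeated for the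
  flow: `‖[α_s(A), B]‖ ≤ 2‖A‖‖B‖ (#X/V) exp(−μ δX + 2e^μ V J s)` on `[0, T]`.

No definitions, no named facts (theorems only).
-/

noncomputable section

open Matrix Complex Set Filter MeasureTheory Topology
open scoped Nat
open scoped Matrix Matrix.Norms.L2Operator Topology

namespace Literature.MathematicalPhysics.QuantumLattice

section Flow

variable {n : Type*} [Fintype n] [DecidableEq n]

/-- **The unitary propagator of a continuous bounded Hermitian generator**: `U' = iD(s)U`,
`U(0) = 1`, `Uᴴ U = U Uᴴ = 1` on `[0, T]` (`exists_unitary_flow` with the trivial `P = 0`).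
[folklore] -/
theorem exists_unitary_propagator {D : ℝ → Matrix n n ℂ} (hDc : Continuous D) {M : ℝ}
    (hDM : ∀ s, ‖D s‖ ≤ M) (hDh : ∀ s, (D s).IsHermitian) (T : ℝ) :
    ∃ U : ℝ → Matrix n n ℂ, U 0 = 1 ∧
      (∀ s ∈ Icc 0 T, HasDerivWithinAt U (((I : ℂ) • D s) * U s) (Icc 0 T) s) ∧
      (∀ s ∈ Icc 0 T, (U s)ᴴ * U s = 1) ∧ (∀ s ∈ Icc 0 T, U s * (U s)ᴴ = 1) := by
  have hP : ∀ s ∈ Icc 0 T, HasDerivWithinAt (fun _ : ℝ => (0 : Matrix n n ℂ))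
      ((I : ℂ) • (D s * (fun _ : ℝ => (0 : Matrix n n ℂ)) s - (fun _ : ℝ => (0 : Matrix n n ℂ)) s * D s))
      (Icc 0 T) s := fun s _ => by
    simpa using hasDerivWithinAt_const s (Icc 0 T) (0 : Matrix n n ℂ)
  obtain ⟨U, hU0, hU, hQ, hQ', -⟩ := exists_unitary_flow hDc hDM hDh T hP
  exact ⟨U, hU0, hU, hQ, hQ'⟩

/-- **Derivative of the flow conjugation** `s ↦ U(s)ᴴ A U(s)` for `U' = B(s) U` with `B(s)ᴴ = −B(s)`:
`(Uᴴ A U)' = Uᴴ (A B − B A) U`. [folklore] -/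
theorem hasDerivWithinAt_conj_flow {U : ℝ → Matrix n n ℂ} {B : Matrix n n ℂ} {S : Set ℝ} {s : ℝ}
    (hU : HasDerivWithinAt U (B * U s) S s) (hB : Bᴴ = -B) (A : Matrix n n ℂ) :
    HasDerivWithinAt (fun u => (U u)ᴴ * A * U u) ((U s)ᴴ * (A * B - B * A) * U s) S s := by
  have h := ((hasDerivWithinAt_conjTranspose hU).mul_const A).mul hU
  refine h.congr_deriv ?_
  simp only [Matrix.conjTranspose_mul, hB]
  noncomm_ring

/-- **The norm-preserving term lemma (time-dependent form of NS06 Lemma A.1).** If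
`f' = f K(s) − K(s) f + h(s)` on `[0, T]` with `K` continuous, bounded and anti-Hermitian, then
`‖f(t)‖ ≤ ‖f(0)‖ + ∫₀ᵗ ‖h(s)‖ ds` (conjugate by the unitary propagator `V' = −K V`:
`(Vᴴ f V)' = Vᴴ h V`). Nachtergaele–Sims 2006, Lemma A.1 / BMNS 2011 proof of Thm 4.6 ("as the
first term above is norm-preserving"). [folklore] -/
theorem norm_le_norm_add_integral_of_hasDerivWithinAt {f h K : ℝ → Matrix n n ℂ}
    (hKc : Continuous K) {M : ℝ} (hKM : ∀ s, ‖K s‖ ≤ M) (hK : ∀ s, (K s)ᴴ = -K s) {T : ℝ}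
    (hh : ContinuousOn h (Icc 0 T))
    (hf : ∀ s ∈ Icc 0 T, HasDerivWithinAt f (f s * K s - K s * f s + h s) (Icc 0 T) s)
    {t : ℝ} (ht : t ∈ Icc 0 T) :
    ‖f t‖ ≤ ‖f 0‖ + ∫ s in (0 : ℝ)..t, ‖h s‖ := by
  -- the generator `D = iK` is Hermitian and `iD = -K`
  have hDh : ∀ s, ((I : ℂ) • K s).IsHermitian := fun s => by
    rw [IsHermitian, conjTranspose_smul, hK s]
    simp
  have hDc : Continuous fun s => (I : ℂ) • K s := hKc.const_smul (I : ℂ)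
  have hDM : ∀ s, ‖(I : ℂ) • K s‖ ≤ M := fun s => by
    rw [norm_smul, Complex.norm_I, one_mul]; exact hKM s
  obtain ⟨V, hV0, hV, hV1, hV2⟩ := exists_unitary_propagator hDc hDM hDh T
  have hII : ∀ s, (I : ℂ) • ((I : ℂ) • K s) = -K s := fun s => by
    rw [smul_smul, Complex.I_mul_I, neg_one_smul]
  have hV' : ∀ s ∈ Icc 0 T, HasDerivWithinAt V (-K s * V s) (Icc 0 T) s := fun s hs => by
    have := hV s hs; rwa [hII s] at this
  have hVu : ∀ s ∈ Icc 0 T, V s ∈ unitary (Matrix n n ℂ) := fun s hs =>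
    Matrix.mem_unitaryGroup_iff'.mpr (hV1 s hs)
  -- `g = Vᴴ f V` has derivative `Vᴴ h V`
  set g : ℝ → Matrix n n ℂ := fun s => (V s)ᴴ * f s * V s with hg
  have hgd : ∀ s ∈ Icc 0 T, HasDerivWithinAt g ((V s)ᴴ * h s * V s) (Icc 0 T) s := by
    intro s hs
    have h1 := ((hasDerivWithinAt_conjTranspose (hV' s hs)).mul (hf s hs)).mul (hV' s hs)
    refine h1.congr_deriv ?_
    simp only [Pi.mul_apply, Matrix.conjTranspose_mul, Matrix.conjTranspose_neg, hK s, neg_neg]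
    noncomm_ring
  -- continuity on the interval
  have hgc : ContinuousOn g (Icc 0 T) := fun s hs => (hgd s hs).continuousWithinAt
  have hVc : ContinuousOn V (Icc 0 T) := fun s hs => (hV s hs).continuousWithinAt
  have hVHc : ContinuousOn (fun s => (V s)ᴴ) (Icc 0 T) := fun s hs =>
    (hasDerivWithinAt_conjTranspose (hV s hs)).continuousWithinAt
  have hg'c : ContinuousOn (fun s => (V s)ᴴ * h s * V s) (Icc 0 T) := (hVHc.mul hh).mul hVc
  -- FTC on `[0, t]`
  have ht0 : (0 : ℝ) ≤ t := ht.1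
  have hsub : Icc 0 t ⊆ Icc 0 T := Icc_subset_Icc le_rfl ht.2
  have hFTC : ∫ s in (0 : ℝ)..t, (V s)ᴴ * h s * V s = g t - g 0 := by
    refine intervalIntegral.integral_eq_sub_of_hasDeriv_right_of_le ht0 (hgc.mono hsub)
      (fun s hs => ?_) ((hg'c.mono ?_).intervalIntegrable)
    · have hs' : s ∈ Icc 0 T := ⟨hs.1.le, hs.2.le.trans ht.2⟩
      have hmem : Icc 0 T ∈ 𝓝[Ioi s] s :=
        mem_of_superset (Icc_mem_nhdsGT (lt_of_lt_of_le hs.2 ht.2)) (Icc_subset_Icc hs.1.le le_rfl)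
      exact (hgd s hs').mono_of_mem_nhdsWithin hmem
    · rw [uIcc_of_le ht0]; exact hsub
  -- norms
  have hg0 : g 0 = f 0 := by simp [hg, hV0]
  have hft : f t = V t * g t * (V t)ᴴ := by
    simp only [hg, ← Matrix.mul_assoc, hV2 t ht, Matrix.one_mul]
    rw [Matrix.mul_assoc, hV2 t ht, Matrix.mul_one]
  have hnorm : ‖f t‖ = ‖g t‖ := by
    rw [hft]
    have hu := hVu t ht
    have hu' : (V t)ᴴ ∈ unitary (Matrix n n ℂ) := by
      rw [← star_eq_conjTranspose]; exact Unitary.star_mem hu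
    exact norm_unitary_mul_mul_unitary hu hu' (g t)
  have hgt : g t = g 0 + ∫ s in (0 : ℝ)..t, (V s)ᴴ * h s * V s := by rw [hFTC]; abel
  calc ‖f t‖ = ‖g t‖ := hnorm
    _ ≤ ‖g 0‖ + ‖∫ s in (0 : ℝ)..t, (V s)ᴴ * h s * V s‖ := by rw [hgt]; exact norm_add_le _ _
    _ ≤ ‖f 0‖ + ∫ s in (0 : ℝ)..t, ‖(V s)ᴴ * h s * V s‖ := by
        rw [hg0]
        exact add_le_add le_rfl (intervalIntegral.norm_integral_le_integral_norm ht0)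
    _ = ‖f 0‖ + ∫ s in (0 : ℝ)..t, ‖h s‖ := by
        congr 1
        refine intervalIntegral.integral_congr fun s hs => ?_
        rw [uIcc_of_le ht0] at hs
        have hu := hVu s (hsub hs)
        have hu' : (V s)ᴴ ∈ unitary (Matrix n n ℂ) := by
          rw [← star_eq_conjTranspose]; exact Unitary.star_mem hu
        exact norm_unitary_mul_mul_unitary hu' hu (h s)

end Flow

/-! ### The integral inequality for flows of time-dependent local interactions -/

section Lattice

open Finset

variable {Λ : Type*} [Fintype Λ] [DecidableEq Λ] {q : ℕ}

/-- Conjugation by the flow is multiplicative: `α(M) α(N) = α(M N)` when `U Uᴴ = 1`. [folklore] -/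
theorem conj_mul_conj {U M N : Op Λ q} (hU : U * Uᴴ = 1) :
    Uᴴ * M * U * (Uᴴ * N * U) = Uᴴ * (M * N) * U := by
  simp only [← Matrix.mul_assoc]
  rw [Matrix.mul_assoc (Uᴴ * M) U Uᴴ, hU, Matrix.mul_one, Matrix.mul_assoc (Uᴴ * M) N]

/-- Conjugation by the flow is additive over finite sums. [folklore] -/
theorem conj_sum {ι : Type*} (S : Finset ι) (U : Op Λ q) (M : ι → Op Λ q) :
    Uᴴ * (∑ i ∈ S, M i) * U = ∑ i ∈ S, Uᴴ * M i * U := by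
  rw [Matrix.mul_sum, Matrix.sum_mul]

/-- Derivative of the commutator `f(s) = [α_s(A), B]` along the flow, in the norm-preserving form
`f' = f K − K f + h` (Jacobi identity), where only the part `B_bd` of the generator that does not
commute with `A` enters: `K = α_s(B_bd)`, `h = [α_s A, [K, B]]`. [folklore] -/
theorem hasDerivWithinAt_comm_conj_flow {U : ℝ → Op Λ q} {Bf Bbd A B : Op Λ q} {S : Set ℝ} {s : ℝ}
    (hU : HasDerivWithinAt U (Bf * U s) S s) (hBf : Bfᴴ = -Bf) (hU2 : U s * (U s)ᴴ = 1)
    (hsplit : A * Bf - Bf * A = A * Bbd - Bbd * A) :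
    HasDerivWithinAt (fun u => (U u)ᴴ * A * U u * B - B * ((U u)ᴴ * A * U u))
      (((U s)ᴴ * A * U s * B - B * ((U s)ᴴ * A * U s)) * ((U s)ᴴ * Bbd * U s) -
          ((U s)ᴴ * Bbd * U s) * ((U s)ᴴ * A * U s * B - B * ((U s)ᴴ * A * U s)) +
        ((U s)ᴴ * A * U s * (((U s)ᴴ * Bbd * U s) * B - B * ((U s)ᴴ * Bbd * U s)) -
          (((U s)ᴴ * Bbd * U s) * B - B * ((U s)ᴴ * Bbd * U s)) * ((U s)ᴴ * A * U s))) S s := by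
  have had : HasDerivWithinAt (fun u => (U u)ᴴ * A * U u)
      ((U s)ᴴ * A * U s * ((U s)ᴴ * Bbd * U s) - ((U s)ᴴ * Bbd * U s) * ((U s)ᴴ * A * U s)) S s := by
    have h1 := hasDerivWithinAt_conj_flow hU hBf A
    refine h1.congr_deriv ?_
    rw [hsplit, Matrix.mul_sub, Matrix.sub_mul, conj_mul_conj hU2, conj_mul_conj hU2]
  have h2 := (had.mul_const B).sub (had.const_mul B)
  refine h2.congr_deriv ?_
  -- Jacobi identity, with atoms `a = α A`, `k = α Bbd`, `b = B`
  generalize (U s)ᴴ * A * U s = a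
  generalize (U s)ᴴ * Bbd * U s = k
  noncomm_ring

/-- The inhomogeneity `h = [α_s A, [K, B]]`, `K = α_s(i H_bd)`, is bounded by
`2‖A‖ Σ_{Z ∩ X ≠ ∅} ‖[α_s(Ψ Z), B]‖`. [folklore] -/
theorem norm_inhomogeneity_le {U A B : Op Λ q} (hU1 : Uᴴ * U = 1) (hU2 : U * Uᴴ = 1)
    (S : Finset (Finset Λ)) (Ψ : Interaction Λ q) :
    ‖Uᴴ * A * U * ((Uᴴ * ((I : ℂ) • ∑ Z ∈ S, Ψ Z) * U) * B - B * (Uᴴ * ((I : ℂ) • ∑ Z ∈ S, Ψ Z) * U)) -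
        ((Uᴴ * ((I : ℂ) • ∑ Z ∈ S, Ψ Z) * U) * B - B * (Uᴴ * ((I : ℂ) • ∑ Z ∈ S, Ψ Z) * U)) *
          (Uᴴ * A * U)‖ ≤
      2 * ‖A‖ * ∑ Z ∈ S, ‖Uᴴ * Ψ Z * U * B - B * (Uᴴ * Ψ Z * U)‖ := by
  have hUu : U ∈ unitary (Op Λ q) := Unitary.mem_iff.2 ⟨hU1, hU2⟩
  have hUu' : Uᴴ ∈ unitary (Op Λ q) := by
    rw [← star_eq_conjTranspose]; exact Unitary.star_mem hUu
  have hna : ‖Uᴴ * A * U‖ = ‖A‖ := norm_unitary_mul_mul_unitary hUu' hUu A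
  have hKB : (Uᴴ * ((I : ℂ) • ∑ Z ∈ S, Ψ Z) * U) * B - B * (Uᴴ * ((I : ℂ) • ∑ Z ∈ S, Ψ Z) * U) =
      (I : ℂ) • (Uᴴ * (∑ Z ∈ S, Ψ Z) * U * B - B * (Uᴴ * (∑ Z ∈ S, Ψ Z) * U)) := by
    simp only [Matrix.mul_smul, Matrix.smul_mul, smul_sub]
  have h2 : ‖(Uᴴ * ((I : ℂ) • ∑ Z ∈ S, Ψ Z) * U) * B - B * (Uᴴ * ((I : ℂ) • ∑ Z ∈ S, Ψ Z) * U)‖ ≤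
      ∑ Z ∈ S, ‖Uᴴ * Ψ Z * U * B - B * (Uᴴ * Ψ Z * U)‖ := by
    rw [hKB, norm_smul, Complex.norm_I, one_mul, conj_sum]
    exact norm_sum_commutator_le _ _ _
  calc _ ≤ 2 * ‖Uᴴ * A * U‖ * ‖(Uᴴ * ((I : ℂ) • ∑ Z ∈ S, Ψ Z) * U) * B -
        B * (Uᴴ * ((I : ℂ) • ∑ Z ∈ S, Ψ Z) * U)‖ := norm_commutator_le _ _
    _ ≤ 2 * ‖A‖ * _ := by rw [hna]; exact mul_le_mul_of_nonneg_left h2 (by positivity)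

/-- Clamping to `[0, T]`. [folklore] -/
theorem clamp_mem_Icc {T : ℝ} (hT : 0 ≤ T) (s : ℝ) : max 0 (min T s) ∈ Icc 0 T :=
  ⟨le_max_left _ _, max_le hT (min_le_left _ _)⟩

/-- The clamp is the identity on `[0, T]`. [folklore] -/
theorem clamp_eq_self {T s : ℝ} (hs : s ∈ Icc 0 T) : max 0 (min T s) = s := by
  rw [min_eq_right hs.2, max_eq_right hs.1]

/-- **The integral inequality for the flow of a time-dependent local interaction** (BMNS 2011,
proof of Thm 4.6; Nachtergaele–Sims 2006 §2). Let `U` be the unitary propagator of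
`s ↦ i Σ_Z Ψ_s(Z)` on `[0, T]` (`U' = (i H(s)) U`, `U(0) = 1`) and `α_s(M) = U(s)ᴴ M U(s)`. For
`A` supported on `X`, any `B` and `t ∈ [0, T]`:
`‖[α_t(A), B]‖ ≤ ‖[A, B]‖ + 2‖A‖ ∫₀ᵗ Σ_{Z ∩ X ≠ ∅} ‖[α_s(Ψ_s(Z)), B]‖ ds`.
(The generator of `α_s(A)` only involves the terms meeting `X`, by locality; Jacobi splits the
derivative of `f = [α_s A, B]` into the norm-preserving part `f K − K f`,
`K = α_s(i H_bd(s))`, and `[α_s A, [K, B]]`.) [folklore] -/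
theorem norm_comm_flow_le_integral_sum {Ψ : ℝ → Interaction Λ q} (hΨ : ∀ s, (Ψ s).IsLocal)
    {T : ℝ} (hΨc : ∀ Z, ContinuousOn (fun s => Ψ s Z) (Icc 0 T)) {U : ℝ → Op Λ q} (hU0 : U 0 = 1)
    (hU : ∀ s ∈ Icc 0 T,
      HasDerivWithinAt U (((I : ℂ) • localHamiltonian (Ψ s) univ) * U s) (Icc 0 T) s)
    (hU1 : ∀ s ∈ Icc 0 T, (U s)ᴴ * U s = 1) (hU2 : ∀ s ∈ Icc 0 T, U s * (U s)ᴴ = 1)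
    {X : Finset Λ} {A : Op Λ q} (hA : IsSupportedOn A X) (B : Op Λ q) {t : ℝ} (ht : t ∈ Icc 0 T) :
    ‖(U t)ᴴ * A * U t * B - B * ((U t)ᴴ * A * U t)‖ ≤ ‖A * B - B * A‖ +
      2 * ‖A‖ * ∫ s in (0 : ℝ)..t, ∑ Z ∈ univ.filter (fun Z : Finset Λ => ¬ Disjoint Z X),
        ‖(U s)ᴴ * Ψ s Z * U s * B - B * ((U s)ᴴ * Ψ s Z * U s)‖ := by
  have hT : 0 ≤ T := ht.1.trans ht.2
  -- the boundary generator, the rotated generator `K` (clamped to the interval) and `h`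
  obtain ⟨Hbd, hHbd⟩ : ∃ Hbd : ℝ → Op Λ q,
      Hbd = fun s => ∑ Z ∈ univ.filter (fun Z : Finset Λ => ¬ Disjoint Z X), Ψ s Z := ⟨_, rfl⟩
  obtain ⟨K, hK⟩ : ∃ K : ℝ → Op Λ q,
      K = fun s => (U (max 0 (min T s)))ᴴ * ((I : ℂ) • Hbd (max 0 (min T s))) * U (max 0 (min T s)) :=
    ⟨_, rfl⟩
  obtain ⟨a, ha⟩ : ∃ a : ℝ → Op Λ q, a = fun s => (U s)ᴴ * A * U s := ⟨_, rfl⟩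
  obtain ⟨f, hf⟩ : ∃ f : ℝ → Op Λ q, f = fun s => a s * B - B * a s := ⟨_, rfl⟩
  obtain ⟨h, hh⟩ : ∃ h : ℝ → Op Λ q,
      h = fun s => a s * (K s * B - B * K s) - (K s * B - B * K s) * a s := ⟨_, rfl⟩
  have hKs : ∀ s ∈ Icc 0 T, K s = (U s)ᴴ * ((I : ℂ) • Hbd s) * U s := fun s hs => by
    rw [hK]; simp only [clamp_eq_self hs]
  -- Hermiticity facts
  have hHh : ∀ s, (localHamiltonian (Ψ s) univ).IsHermitian := fun s =>
    localHamiltonian_isHermitian (hΨ s) univ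
  have hbdh : ∀ s, (Hbd s).IsHermitian := fun s => by
    rw [hHbd]; exact isHermitian_sum_interaction (hΨ s) _
  have hsplit : ∀ s, A * ((I : ℂ) • localHamiltonian (Ψ s) univ) -
      ((I : ℂ) • localHamiltonian (Ψ s) univ) * A = A * ((I : ℂ) • Hbd s) - ((I : ℂ) • Hbd s) * A := by
    intro s
    have hc := (hΨ s).commute_sum_filter_disjoint hA
    have hdec : localHamiltonian (Ψ s) univ =
        (∑ Z ∈ univ.filter (fun Z : Finset Λ => Disjoint Z X), Ψ s Z) + Hbd s := by
      rw [localHamiltonian_univ, hHbd]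
      exact (sub_eq_iff_eq_add'.mp (sum_sub_sum_filter_disjoint (Ψ s) X))
    rw [hdec, smul_add, Matrix.mul_add, Matrix.add_mul, Matrix.mul_smul, Matrix.smul_mul, hc.eq.symm]
    abel
  -- the derivative of `f`
  have hfd : ∀ s ∈ Icc 0 T, HasDerivWithinAt f (f s * K s - K s * f s + h s) (Icc 0 T) s := by
    intro s hs
    have h1 := hasDerivWithinAt_comm_conj_flow (B := B) (hU s hs)
      (conjTranspose_I_smul_of_isHermitian (hHh s)) (hU2 s hs) (hsplit s)
    have hfun : f = fun u => (U u)ᴴ * A * U u * B - B * ((U u)ᴴ * A * U u) := by rw [hf, ha]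
    rw [hfun]
    refine h1.congr_deriv ?_
    have hhs : h s = (U s)ᴴ * A * U s * (((U s)ᴴ * ((I : ℂ) • Hbd s) * U s) * B -
        B * ((U s)ᴴ * ((I : ℂ) • Hbd s) * U s)) -
        (((U s)ᴴ * ((I : ℂ) • Hbd s) * U s) * B - B * ((U s)ᴴ * ((I : ℂ) • Hbd s) * U s)) *
          ((U s)ᴴ * A * U s) := by
      rw [hh, ha]
      beta_reduce
      rw [hKs s hs]
    have hfs : (fun u => (U u)ᴴ * A * U u * B - B * ((U u)ᴴ * A * U u)) s =
        (U s)ᴴ * A * U s * B - B * ((U s)ᴴ * A * U s) := rfl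
    rw [hhs, hfs, hKs s hs]
  -- `K` is continuous, bounded and anti-Hermitian on `ℝ`; `h` is continuous on the interval
  have hUc : ContinuousOn U (Icc 0 T) := fun s hs => (hU s hs).continuousWithinAt
  have hUHc : ContinuousOn (fun s => (U s)ᴴ) (Icc 0 T) := fun s hs =>
    (hasDerivWithinAt_conjTranspose (hU s hs)).continuousWithinAt
  have hHbdc : ContinuousOn Hbd (Icc 0 T) := by
    rw [hHbd]
    exact continuousOn_finsetSum _ fun Z _ => hΨc Z
  have hK0c : ContinuousOn (fun s => (U s)ᴴ * ((I : ℂ) • Hbd s) * U s) (Icc 0 T) :=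
    (hUHc.mul (hHbdc.const_smul (I : ℂ))).mul hUc
  have hcc : Continuous fun s : ℝ => max 0 (min T s) :=
    continuous_const.max (continuous_const.min continuous_id)
  have hKc : Continuous K := by
    rw [hK]
    exact hK0c.comp_continuous hcc (clamp_mem_Icc hT)
  obtain ⟨M, hM⟩ : ∃ M, ∀ s, ‖K s‖ ≤ M := by
    obtain ⟨M, hM⟩ := (isCompact_Icc (a := (0:ℝ)) (b := T)).exists_bound_of_continuousOn hK0c
    refine ⟨M, fun s => ?_⟩
    rw [hK]
    exact hM _ (clamp_mem_Icc hT s)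
  have hKanti : ∀ s, (K s)ᴴ = -K s := by
    intro s
    rw [hK]
    simp only [Matrix.conjTranspose_mul, Matrix.conjTranspose_conjTranspose,
      conjTranspose_I_smul_of_isHermitian (hbdh _), Matrix.mul_neg, Matrix.neg_mul, Matrix.mul_assoc]
  have hKcOn : ContinuousOn K (Icc 0 T) := hKc.continuousOn
  have hac : ContinuousOn a (Icc 0 T) := by
    rw [ha]; exact (hUHc.mul continuousOn_const).mul hUc
  have hhc : ContinuousOn h (Icc 0 T) := by
    rw [hh]
    exact (hac.mul ((hKcOn.mul continuousOn_const).sub (continuousOn_const.mul hKcOn))).sub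
      (((hKcOn.mul continuousOn_const).sub (continuousOn_const.mul hKcOn)).mul hac)
  -- the norm-preserving lemma
  have hmain := norm_le_norm_add_integral_of_hasDerivWithinAt hKc hM hKanti hhc hfd ht
  have hf0 : f 0 = A * B - B * A := by
    rw [hf, ha]; simp only [hU0, Matrix.conjTranspose_one, Matrix.one_mul, Matrix.mul_one]
  have hft : f t = (U t)ᴴ * A * U t * B - B * ((U t)ᴴ * A * U t) := by rw [hf, ha]
  rw [hf0, hft] at hmain
  refine hmain.trans (add_le_add le_rfl ?_)
  -- bound `‖h s‖` and integrate
  have hbound : ∀ s ∈ Icc 0 T, ‖h s‖ ≤ 2 * ‖A‖ *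
      ∑ Z ∈ univ.filter (fun Z : Finset Λ => ¬ Disjoint Z X),
        ‖(U s)ᴴ * Ψ s Z * U s * B - B * ((U s)ᴴ * Ψ s Z * U s)‖ := by
    intro s hs
    have hhs : h s = (U s)ᴴ * A * U s * (((U s)ᴴ * ((I : ℂ) • Hbd s) * U s) * B -
        B * ((U s)ᴴ * ((I : ℂ) • Hbd s) * U s)) -
        (((U s)ᴴ * ((I : ℂ) • Hbd s) * U s) * B - B * ((U s)ᴴ * ((I : ℂ) • Hbd s) * U s)) *
          ((U s)ᴴ * A * U s) := by
      rw [hh, ha]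
      beta_reduce
      rw [hKs s hs]
    have hHbds : Hbd s = ∑ Z ∈ univ.filter (fun Z : Finset Λ => ¬ Disjoint Z X), Ψ s Z := by
      rw [hHbd]
    rw [hhs, hHbds]
    exact norm_inhomogeneity_le (hU1 s hs) (hU2 s hs) _ (Ψ s)
  have ht0 : (0 : ℝ) ≤ t := ht.1
  have hsub : Icc 0 t ⊆ Icc 0 T := Icc_subset_Icc le_rfl ht.2
  have hsub' : uIcc 0 t ⊆ Icc 0 T := by rw [uIcc_of_le ht0]; exact hsub
  have hgc : ContinuousOn (fun s => ∑ Z ∈ univ.filter (fun Z : Finset Λ => ¬ Disjoint Z X),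
      ‖(U s)ᴴ * Ψ s Z * U s * B - B * ((U s)ᴴ * Ψ s Z * U s)‖) (Icc 0 T) := by
    refine continuousOn_finsetSum _ fun Z _ => ?_
    have hZc : ContinuousOn (fun s => (U s)ᴴ * Ψ s Z * U s) (Icc 0 T) := (hUHc.mul (hΨc Z)).mul hUc
    exact ((hZc.mul continuousOn_const).sub (continuousOn_const.mul hZc)).norm
  calc ∫ s in (0 : ℝ)..t, ‖h s‖
      ≤ ∫ s in (0 : ℝ)..t, 2 * ‖A‖ * ∑ Z ∈ univ.filter (fun Z : Finset Λ => ¬ Disjoint Z X),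
          ‖(U s)ᴴ * Ψ s Z * U s * B - B * ((U s)ᴴ * Ψ s Z * U s)‖ := by
        refine intervalIntegral.integral_mono_on ht0 ?_ ?_ fun s hs => hbound s (hsub hs)
        · exact (hhc.norm.mono hsub').intervalIntegrable
        · exact ((continuousOn_const.mul hgc).mono hsub').intervalIntegrable
    _ = 2 * ‖A‖ * ∫ s in (0 : ℝ)..t, ∑ Z ∈ univ.filter (fun Z : Finset Λ => ¬ Disjoint Z X),
          ‖(U s)ᴴ * Ψ s Z * U s * B - B * ((U s)ᴴ * Ψ s Z * U s)‖ :=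
        intervalIntegral.integral_const_mul _ _

/-! ### Iteration: the Lieb–Robinson bound for flows of finite-range time-dependent interactions -/

set_option maxHeartbeats 1000000 in
/-- **The iterated inequality for flows** (time-dependent clone of `norm_comm_le_iterate`). For a
time-dependent local interaction `Ψ_s` on `[0, T]` whose non-zero terms satisfy a predicate `R`
(e.g. `diam ≤ r₀`), with `Σ_{Z ∋ x} ‖Ψ_s Z‖ ≤ J`, `#Z ≤ V` on `R`, `B ∈ 𝔄_Y` and a grading `δ` with
`δ Z > 0 ⟹ Z ∩ Y = ∅`, `δ Z ≤ δ Z' + 1` whenever `R Z'` and `Z'` meets `Z`: for `A ∈ 𝔄_X`,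
`s ∈ [0, T]` and every `N`,
`‖[α_s(A), B]‖ ≤ 2‖A‖‖B‖ (𝟙[δX = 0] + (#X/V)(Σ_{n=max(1,δX)}^{N} (cs)ⁿ/n! + (cs)^{N+1}/(N+1)!))`,
`c = 2VJ`. BMNS 2011, proof of Thm 4.6 ("From here, the argument proceeds as in the proof of
Theorem 2.1 in [NS06]"). [folklore] -/
theorem norm_comm_flow_le_iterate {Ψ : ℝ → Interaction Λ q} (hΨ : ∀ s, (Ψ s).IsLocal)
    {T : ℝ} (hΨc : ∀ Z, ContinuousOn (fun s => Ψ s Z) (Icc 0 T)) {U : ℝ → Op Λ q} (hU0 : U 0 = 1)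
    (hU : ∀ s ∈ Icc 0 T,
      HasDerivWithinAt U (((I : ℂ) • localHamiltonian (Ψ s) univ) * U s) (Icc 0 T) s)
    (hU1 : ∀ s ∈ Icc 0 T, (U s)ᴴ * U s = 1) (hU2 : ∀ s ∈ Icc 0 T, U s * (U s)ᴴ = 1)
    {R : Finset Λ → Prop} (hR : ∀ s ∈ Icc 0 T, ∀ Z, Ψ s Z ≠ 0 → R Z)
    {Y : Finset Λ} {B : Op Λ q} (hB : IsSupportedOn B Y) (δ : Finset Λ → ℕ)
    (hδY : ∀ Z, 0 < δ Z → Disjoint Z Y) (hδ : ∀ Z Z', R Z' → ¬ Disjoint Z' Z → δ Z ≤ δ Z' + 1)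
    {J : ℝ} (hJ0 : 0 ≤ J)
    (hJ : ∀ s ∈ Icc 0 T, ∀ x : Λ, ∑ Z ∈ univ.filter (fun Z : Finset Λ => x ∈ Z), ‖Ψ s Z‖ ≤ J)
    {V : ℕ} (hV1 : 1 ≤ V) (hV : ∀ Z, R Z → #Z ≤ V) (N : ℕ) :
    ∀ (X : Finset Λ) (A : Op Λ q), IsSupportedOn A X → ∀ s ∈ Icc 0 T,
      ‖(U s)ᴴ * A * U s * B - B * ((U s)ᴴ * A * U s)‖ ≤
        2 * ‖A‖ * ‖B‖ * ((if δ X = 0 then 1 else 0) + (#X / V) *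
          (∑ n ∈ Finset.Icc (max 1 (δ X)) N, (2 * V * J * s) ^ n / n ! +
            (2 * V * J * s) ^ (N + 1) / (N + 1)!)) := by
  have hVpos : (0 : ℝ) < V := by exact_mod_cast hV1
  have hc0 : 0 ≤ 2 * (V : ℝ) * J := by positivity
  have hUu : ∀ s ∈ Icc 0 T, U s ∈ unitary (Op Λ q) := fun s hs =>
    Matrix.mem_unitaryGroup_iff'.mpr (hU1 s hs)
  have hUu' : ∀ s ∈ Icc 0 T, (U s)ᴴ ∈ unitary (Op Λ q) := fun s hs => by
    rw [← star_eq_conjTranspose]; exact Unitary.star_mem (hUu s hs)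
  have hnormα : ∀ s ∈ Icc 0 T, ∀ M : Op Λ q, ‖(U s)ᴴ * M * U s‖ = ‖M‖ := fun s hs M =>
    norm_unitary_mul_mul_unitary (hUu' s hs) (hUu s hs) M
  -- the initial commutator
  have hinit : ∀ (X : Finset Λ) (A : Op Λ q), IsSupportedOn A X →
      ‖A * B - B * A‖ ≤ 2 * ‖A‖ * ‖B‖ * (if δ X = 0 then 1 else 0) := by
    intro X A hA
    by_cases h0 : δ X = 0
    · rw [if_pos h0, mul_one]; exact norm_commutator_le A B
    · rw [if_neg h0, mul_zero]
      have hdisj : Disjoint X Y := hδY X (Nat.pos_of_ne_zero h0)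
      rw [(commute_of_disjoint_holds hA hB hdisj).eq, sub_self, norm_zero]
  -- the terms touching `X`
  have hsumX : ∀ s ∈ Icc 0 T, ∀ X : Finset Λ,
      ∑ Z ∈ univ.filter (fun Z : Finset Λ => ¬ Disjoint Z X), ‖Ψ s Z‖ ≤ #X * J :=
    fun s hs X => sum_norm_filter_not_disjoint_le (hJ s hs) X
  -- continuity of the integrand on the interval
  have hUc : ContinuousOn U (Icc 0 T) := fun s hs => (hU s hs).continuousWithinAt
  have hUHc : ContinuousOn (fun s => (U s)ᴴ) (Icc 0 T) := fun s hs =>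
    (hasDerivWithinAt_conjTranspose (hU s hs)).continuousWithinAt
  have hcontsum : ∀ X : Finset Λ, ContinuousOn (fun u : ℝ =>
      ∑ Z ∈ univ.filter (fun Z : Finset Λ => ¬ Disjoint Z X),
        ‖(U u)ᴴ * Ψ u Z * U u * B - B * ((U u)ᴴ * Ψ u Z * U u)‖) (Icc 0 T) := fun X => by
    refine continuousOn_finsetSum _ fun Z _ => ?_
    have hZc : ContinuousOn (fun s => (U s)ᴴ * Ψ s Z * U s) (Icc 0 T) := (hUHc.mul (hΨc Z)).mul hUc
    exact ((hZc.mul continuousOn_const).sub (continuousOn_const.mul hZc)).norm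
  have hsubI : ∀ s ∈ Icc 0 T, uIcc 0 s ⊆ Icc 0 T := fun s hs => by
    rw [uIcc_of_le hs.1]; exact Icc_subset_Icc le_rfl hs.2
  induction N with
  | zero =>
    intro X A hA s hs
    have hs0 : (0 : ℝ) ≤ s := hs.1
    have hcore := norm_comm_flow_le_integral_sum hΨ hΨc hU0 hU hU1 hU2 hA B hs
    -- trivial bound on the integrand
    have hint : ∫ u in (0:ℝ)..s, ∑ Z ∈ univ.filter (fun Z : Finset Λ => ¬ Disjoint Z X),
        ‖(U u)ᴴ * Ψ u Z * U u * B - B * ((U u)ᴴ * Ψ u Z * U u)‖ ≤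
        ∫ u in (0:ℝ)..s, 2 * ‖B‖ * (#X * J) := by
      refine intervalIntegral.integral_mono_on hs0 (((hcontsum X).mono (hsubI s hs)).intervalIntegrable)
        intervalIntegrable_const fun u hu => ?_
      have hu' : u ∈ Icc 0 T := ⟨hu.1, hu.2.trans hs.2⟩
      calc ∑ Z ∈ univ.filter (fun Z : Finset Λ => ¬ Disjoint Z X),
            ‖(U u)ᴴ * Ψ u Z * U u * B - B * ((U u)ᴴ * Ψ u Z * U u)‖
          ≤ ∑ Z ∈ univ.filter (fun Z : Finset Λ => ¬ Disjoint Z X), 2 * ‖B‖ * ‖Ψ u Z‖ := by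
            refine sum_le_sum fun Z _ => ?_
            calc _ ≤ 2 * ‖(U u)ᴴ * Ψ u Z * U u‖ * ‖B‖ := norm_commutator_le _ _
              _ = 2 * ‖B‖ * ‖Ψ u Z‖ := by rw [hnormα u hu']; ring
        _ = 2 * ‖B‖ * ∑ Z ∈ univ.filter (fun Z : Finset Λ => ¬ Disjoint Z X), ‖Ψ u Z‖ := by
            rw [mul_sum]
        _ ≤ 2 * ‖B‖ * (#X * J) := mul_le_mul_of_nonneg_left (hsumX u hu' X) (by positivity)
    rw [intervalIntegral.integral_const, sub_zero, smul_eq_mul] at hint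
    have h1 := hinit X A hA
    have hIcc : Finset.Icc (max 1 (δ X)) 0 = ∅ := by
      ext n
      simp only [Finset.mem_Icc, Finset.notMem_empty, iff_false, not_and, not_le]
      omega
    rw [hIcc, sum_empty, zero_add, zero_add, Nat.factorial_one, Nat.cast_one, div_one, pow_one]
    calc _ ≤ ‖A * B - B * A‖ + 2 * ‖A‖ * (s * (2 * ‖B‖ * (#X * J))) :=
          hcore.trans (add_le_add le_rfl (mul_le_mul_of_nonneg_left hint (by positivity)))
      _ ≤ 2 * ‖A‖ * ‖B‖ * (if δ X = 0 then 1 else 0) + 2 * ‖A‖ * (s * (2 * ‖B‖ * (#X * J))) :=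
          add_le_add h1 le_rfl
      _ = 2 * ‖A‖ * ‖B‖ * ((if δ X = 0 then 1 else 0) + (#X / V) * (2 * V * J * s)) := by
          have hVne : (V : ℝ) ≠ 0 := ne_of_gt hVpos
          have hcc : (#X : ℝ) / V * (2 * V * J * s) = 2 * (#X * J) * s := by
            calc (#X : ℝ) / V * (2 * V * J * s) = 2 * (#X * J) * s * (V / V) := by ring
              _ = 2 * (#X * J) * s := by rw [div_self hVne, mul_one]
          rw [hcc]
          ring
  | succ N ih =>
    intro X A hA s hs
    have hs0 : (0 : ℝ) ≤ s := hs.1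
    have hcore := norm_comm_flow_le_integral_sum hΨ hΨc hU0 hU hU1 hU2 hA B hs
    set c : ℝ := 2 * V * J with hc
    set a : ℕ := max 1 (δ X - 1) with ha
    -- the integrand bound `g`
    set g : ℝ → ℝ := fun u => 2 * ‖B‖ * ((if δ X ≤ 1 then 1 else 0) +
      (∑ n ∈ Finset.Icc a N, (c * u) ^ n / n ! + (c * u) ^ (N + 1) / (N + 1)!)) with hg
    have hg0 : ∀ u, 0 ≤ u → 0 ≤ g u := fun u hu => by
      simp only [hg]
      have : 0 ≤ c * u := mul_nonneg hc0 hu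
      positivity
    have hgc : Continuous g := by
      simp only [hg]
      fun_prop
    -- pointwise bound of each term by `‖Ψ u Z‖ g u` (induction hypothesis at `Z`)
    have hterm : ∀ u ∈ Icc 0 s, ∀ Z ∈ univ.filter (fun Z : Finset Λ => ¬ Disjoint Z X),
        ‖(U u)ᴴ * Ψ u Z * U u * B - B * ((U u)ᴴ * Ψ u Z * U u)‖ ≤ ‖Ψ u Z‖ * g u := by
      intro u hu Z hZ
      have hu' : u ∈ Icc 0 T := ⟨hu.1, hu.2.trans hs.2⟩
      simp only [Finset.mem_filter, Finset.mem_univ, true_and] at hZ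
      by_cases hΨZ : Ψ u Z = 0
      · simp only [hΨZ, Matrix.mul_zero, sub_self, norm_zero, zero_mul, le_refl]
      have hIH := ih Z (Ψ u Z) ((hΨ u).isSupportedOn Z) u hu'
      have hRZ : R Z := hR u hu' Z hΨZ
      have hδZ : δ X ≤ δ Z + 1 := hδ X Z hRZ hZ
      have hZV : (#Z : ℝ) / V ≤ 1 := by
        rw [div_le_one hVpos]
        exact_mod_cast hV Z hRZ
      refine hIH.trans ?_
      rw [show 2 * ‖Ψ u Z‖ * ‖B‖ = ‖Ψ u Z‖ * (2 * ‖B‖) by ring, hg, mul_assoc]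
      refine mul_le_mul_of_nonneg_left (mul_le_mul_of_nonneg_left (add_le_add ?_ ?_)
        (by positivity)) (norm_nonneg _)
      · -- `𝟙[δZ = 0] ≤ 𝟙[δX ≤ 1]`
        by_cases hZ0 : δ Z = 0
        · rw [if_pos hZ0, if_pos (by omega)]
        · rw [if_neg hZ0]
          split_ifs <;> norm_num
      · have hcu : 0 ≤ c * u := mul_nonneg hc0 hu.1
        have hsub : Finset.Icc (max 1 (δ Z)) N ⊆ Finset.Icc a N :=
          Finset.Icc_subset_Icc (by omega) le_rfl
        calc (#Z : ℝ) / V * (∑ n ∈ Finset.Icc (max 1 (δ Z)) N, (c * u) ^ n / n ! +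
              (c * u) ^ (N + 1) / (N + 1)!)
            ≤ 1 * (∑ n ∈ Finset.Icc (max 1 (δ Z)) N, (c * u) ^ n / n ! +
              (c * u) ^ (N + 1) / (N + 1)!) :=
              mul_le_mul_of_nonneg_right hZV (by positivity)
          _ ≤ ∑ n ∈ Finset.Icc a N, (c * u) ^ n / n ! + (c * u) ^ (N + 1) / (N + 1)! := by
              rw [one_mul]
              exact add_le_add
                (sum_le_sum_of_subset_of_nonneg hsub fun n _ _ => by positivity) le_rfl
    -- integrate the bound
    set T' : ℝ := s * (if δ X ≤ 1 then 1 else 0) +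
      (∑ n ∈ Finset.Icc a N, c ^ n * s ^ (n + 1) / (n + 1)! + c ^ (N + 1) * s ^ (N + 2) / (N + 2)!)
      with hT'
    have hint : ∫ u in (0:ℝ)..s, ∑ Z ∈ univ.filter (fun Z : Finset Λ => ¬ Disjoint Z X),
        ‖(U u)ᴴ * Ψ u Z * U u * B - B * ((U u)ᴴ * Ψ u Z * U u)‖ ≤
        (#X * J) * (2 * ‖B‖ * T') := by
      have heval : ∫ u in (0:ℝ)..s, (#X * J) * g u = (#X * J) * (2 * ‖B‖ * T') := by
        rw [intervalIntegral.integral_const_mul, hg, integral_iterBound]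
      rw [← heval]
      refine intervalIntegral.integral_mono_on hs0
        (((hcontsum X).mono (hsubI s hs)).intervalIntegrable)
        ((continuous_const.mul hgc).intervalIntegrable 0 s) fun u hu => ?_
      have hu' : u ∈ Icc 0 T := ⟨hu.1, hu.2.trans hs.2⟩
      calc _ ≤ ∑ Z ∈ univ.filter (fun Z : Finset Λ => ¬ Disjoint Z X), ‖Ψ u Z‖ * g u :=
            sum_le_sum (hterm u hu)
        _ = (∑ Z ∈ univ.filter (fun Z : Finset Λ => ¬ Disjoint Z X), ‖Ψ u Z‖) * g u := by
            rw [sum_mul]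
        _ ≤ (#X * J) * g u := mul_le_mul_of_nonneg_right (hsumX u hu' X) (hg0 u hu.1)
    -- `c T' ≤ Σ' + last'`
    have hcT : c * T' ≤ ∑ n ∈ Finset.Icc (max 1 (δ X)) (N + 1), (c * s) ^ n / n ! +
        (c * s) ^ (N + 2) / (N + 2)! := by
      have hre := mul_indicator_add_sum_Icc_le (c * s) (δ X) N
      have hpow : ∀ n : ℕ, c * (c ^ n * s ^ (n + 1) / (n + 1)!) = (c * s) ^ (n + 1) / (n + 1)! := by
        intro n; rw [mul_pow]; ring
      rw [hT', mul_add, mul_add, mul_sum]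
      simp only [hpow, ← add_assoc]
      refine add_le_add ?_ le_rfl
      rw [show c * (s * (if δ X ≤ 1 then 1 else 0)) = c * s * (if δ X ≤ 1 then 1 else 0) by ring,
        ha]
      exact hre
    have h1 := hinit X A hA
    have hXV : (0 : ℝ) ≤ #X / V := by positivity
    calc _ ≤ ‖A * B - B * A‖ + 2 * ‖A‖ * ((#X * J) * (2 * ‖B‖ * T')) :=
          hcore.trans (add_le_add le_rfl (mul_le_mul_of_nonneg_left hint (by positivity)))
      _ = ‖A * B - B * A‖ + 2 * ‖A‖ * ‖B‖ * ((#X / V) * (c * T')) := by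
          have hVne : (V : ℝ) ≠ 0 := ne_of_gt hVpos
          have hcc : (#X : ℝ) / V * c = 2 * (#X * J) := by
            calc (#X : ℝ) / V * c = 2 * (#X * J) * (V / V) := by rw [hc]; ring
              _ = 2 * (#X * J) := by rw [div_self hVne, mul_one]
          rw [← mul_assoc ((#X : ℝ) / V) c T', hcc]
          ring
      _ ≤ 2 * ‖A‖ * ‖B‖ * (if δ X = 0 then 1 else 0) + 2 * ‖A‖ * ‖B‖ * ((#X / V) *
          (∑ n ∈ Finset.Icc (max 1 (δ X)) (N + 1), (c * s) ^ n / n ! + (c * s) ^ (N + 2) / (N + 2)!)) :=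
          add_le_add h1 (mul_le_mul_of_nonneg_left (mul_le_mul_of_nonneg_left hcT hXV)
            (by positivity))
      _ = _ := by rw [← mul_add]

/-- **Lieb–Robinson bound for the flow of a finite-range time-dependent interaction.** Under the
hypotheses of `norm_comm_flow_le_iterate`, for `A ∈ 𝔄_X` with `δ X ≥ 1`, `0 ≤ μ` and
`s ∈ [0, T]`: `‖[α_s(A), B]‖ ≤ 2‖A‖‖B‖ (#X/V) exp(−μ δX + 2 e^μ V J s)`. BMNS 2011 Thm 4.6
(finite-range case); Nachtergaele–Sims 2006 Thm 1. [folklore] -/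
theorem norm_comm_flow_le_exp {Ψ : ℝ → Interaction Λ q} (hΨ : ∀ s, (Ψ s).IsLocal)
    {T : ℝ} (hΨc : ∀ Z, ContinuousOn (fun s => Ψ s Z) (Icc 0 T)) {U : ℝ → Op Λ q} (hU0 : U 0 = 1)
    (hU : ∀ s ∈ Icc 0 T,
      HasDerivWithinAt U (((I : ℂ) • localHamiltonian (Ψ s) univ) * U s) (Icc 0 T) s)
    (hU1 : ∀ s ∈ Icc 0 T, (U s)ᴴ * U s = 1) (hU2 : ∀ s ∈ Icc 0 T, U s * (U s)ᴴ = 1)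
    {R : Finset Λ → Prop} (hR : ∀ s ∈ Icc 0 T, ∀ Z, Ψ s Z ≠ 0 → R Z)
    {X Y : Finset Λ} {A B : Op Λ q} (hA : IsSupportedOn A X) (hB : IsSupportedOn B Y)
    (δ : Finset Λ → ℕ) (hδY : ∀ Z, 0 < δ Z → Disjoint Z Y)
    (hδ : ∀ Z Z', R Z' → ¬ Disjoint Z' Z → δ Z ≤ δ Z' + 1) (hX : 0 < δ X) {J : ℝ} (hJ0 : 0 ≤ J)
    (hJ : ∀ s ∈ Icc 0 T, ∀ x : Λ, ∑ Z ∈ univ.filter (fun Z : Finset Λ => x ∈ Z), ‖Ψ s Z‖ ≤ J)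
    {V : ℕ} (hV1 : 1 ≤ V) (hV : ∀ Z, R Z → #Z ≤ V) {μ : ℝ} (hμ : 0 ≤ μ) {s : ℝ}
    (hs : s ∈ Icc 0 T) :
    ‖(U s)ᴴ * A * U s * B - B * ((U s)ᴴ * A * U s)‖ ≤
      2 * ‖A‖ * ‖B‖ * (#X / V) * Real.exp (-(μ * δ X) + 2 * Real.exp μ * V * J * s) := by
  set c : ℝ := 2 * V * J with hc
  have hc0 : 0 ≤ c := by rw [hc]; positivity
  have hcs : 0 ≤ c * s := mul_nonneg hc0 hs.1
  set L : ℝ := ‖(U s)ᴴ * A * U s * B - B * ((U s)ᴴ * A * U s)‖ with hL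
  have hN : ∀ N : ℕ, L ≤ 2 * ‖A‖ * ‖B‖ * ((#X / V) *
      (Real.exp (-(μ * δ X)) * Real.exp (Real.exp μ * (c * s)) +
        (c * s) ^ (N + 1) / (N + 1)!)) := by
    intro N
    have h := norm_comm_flow_le_iterate hΨ hΨc hU0 hU hU1 hU2 hR hB δ hδY hδ hJ0 hJ hV1 hV N X A hA
      s hs
    rw [if_neg (Nat.pos_iff_ne_zero.mp hX), zero_add, ← hc,
      show max 1 (δ X) = δ X from max_eq_right hX] at h
    refine h.trans (mul_le_mul_of_nonneg_left (mul_le_mul_of_nonneg_left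
      (add_le_add ?_ le_rfl) (by positivity)) (by positivity))
    exact sum_Icc_pow_div_factorial_le hcs hμ (δ X) N
  have hlim : Tendsto (fun N : ℕ => 2 * ‖A‖ * ‖B‖ * ((#X / V) *
      (Real.exp (-(μ * δ X)) * Real.exp (Real.exp μ * (c * s)) +
        (c * s) ^ (N + 1) / (N + 1)!))) atTop
      (𝓝 (2 * ‖A‖ * ‖B‖ * ((#X / V) *
        (Real.exp (-(μ * δ X)) * Real.exp (Real.exp μ * (c * s)) + 0)))) := by
    have h0 : Tendsto (fun N : ℕ => (c * s) ^ (N + 1) / (N + 1)!) atTop (𝓝 0) :=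
      (FloorSemiring.tendsto_pow_div_factorial_atTop (c * s)).comp (tendsto_add_atTop_nat 1)
    exact tendsto_const_nhds.mul (tendsto_const_nhds.mul (tendsto_const_nhds.add h0))
  have hle := ge_of_tendsto' hlim hN
  rw [add_zero] at hle
  refine hle.trans (le_of_eq ?_)
  rw [Real.exp_add, hc]
  ring_nf

end Lattice

end Literature.MathematicalPhysics.QuantumLattice
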